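import Summits.QuantumFields.BalabanUV.T4Continuum.Support.ShellMeasureGradientTailHDLocal
import Summits.QuantumFields.BalabanUV.T4Continuum.Support.ShellMeasureGradientTailHD

/-!
# `T4Continuum.ShellMeasureGradientTailHDJunction` — WALL §2 (a) item (P4), the `HD`-terms of [Balaban1985Variational]
# (80): THE JUNCTION between the crew's POTENTIAL-LEVEL typing (S66 f1 `ShellMeasureGradientTailHD`) and the owner's
# BOND-LOCAL typing (S66 f2a∕f2b `ShellMeasureGradientTailPairing`∕`…HDLocal`) ON A COMMON INSTANCE: the two (98)
# currencies `Prop4Hyp (fderiv ℂ V)` ∕ `Prop4Hyp (locGrad V)` transfer into each other with the volume factor `#Λ`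
# displayed exactly once, f2b's `termsHD` IS f1's (80)-functional for constructed `Jf`∕`P`, and BOTH files' END
# theorems FIRE on that one functional — f1's with `#Λ` in three places, f2b's with none (cell `pub-balaban`, sub-cell
# `t4`, spine estimate NE7c (node U5b); NE7c ROUND-2 crew, unit `b2b-balaban-t4-ne7c-formalise-leaf-07` gen 5, owner
# table `LEAVES-NE7c-P1.md` row S66 file 4 = the owner's open crew item «the junction f1 (potential level) ↔ f2 (bond-
# local) on a common instance»; ADDITIVE — imports f2b `ShellMeasureGradientTailHDLocal` (hence f2a, S62 f1∕f3) and f1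
# `ShellMeasureGradientTailHD` ONLY, BY NAME, nothing restated; [folklore]; 0 sorry)

HONEST FRAMING.  Finite four-torus programme, rung (B)+1 only — NOT infinite volume, NOT a mass gap, NOT the Clay
problem, NOT summit progress; (B), `BetaPertHyp`, (B^μ) are not consumed.  NE7c (`T4IndicatorShell.ShellWeightBound`)
is NOT PRINTED and NOT PROVED; «NE7c ⇐ the named binders» (WALL `t4/b2b-balaban-t4-ne7c-p1/WALL-NE7c-P1.md` §2).
Elementary calculus on complex normed spaces ([folklore]); nothing printed is asserted or cited as a fact — B11 p. 290
(80) and p. 291 (85)–(89) are LOCATORS for the SHAPE only; the operators `H` ((46) = [5] Thm 3.12, the deep wall), `D`∕`D₃`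
(the `Cf` item (55)∕(73)) and `Δ` ([5] (3.132)) are BINDERS throughout, never constructed or estimated here.  No
`def … : Prop` (the two `def`s are DATA: the pairing functionals `pairCLM`, `pairBil`).  HONEST DEPENDENCY (cell):
continuum YM on T⁴ ⇐ BetaPertH ∧ nine spine estimates (0/9 proved); BetaPertH ⇐ (D1) ∧ (D4) ∧ CAP+tail; G-an2-4 gates
asym, D1 and NE2/3/4.

THE POINT (owner, journal LANDED NE7c-S66 f2a: «f1's potential-level binders go EXTENSIVE on sup-normed bond fields (dual
of sup = ℓ¹; one global `K₀ ∝ #Pl`); the per-bond (85)–(89) are paid for by kernel decay»).  Here that sentence becomes a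
pair of kernel theorems about ONE object, on the bond fields `Λ → 𝔄` (`Λ` finite, sup norm):
* §1 (J1) TRANSFER.  **`prop4Hyp_locGrad_of_fderiv`**: `Prop4Hyp (fderiv ℂ V) C r → Prop4Hyp (locGrad V) C r` (SAME
  constant: `‖locGrad V A‖_∞ ≤ ‖DV(A)‖` as `‖ι_b‖ ≤ 1`); **`prop4Hyp_fderiv_of_locGrad`**: `Prop4Hyp (locGrad V) C r →
  Prop4Hyp (fderiv ℂ V) (#Λ·C) r` (f2a's key device + `‖h‖₁ ≤ #Λ‖h‖_∞`) — the volume factor, displayed once and only in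
  this direction; `differentiableOn_locGrad_iff` (the analyticity clauses coincide).
* §2 (J2) THE COMMON INSTANCE.  `pairCLM π J = ⟨J, ·⟩_π` (`‖·‖ ≤ ‖π‖·‖J‖₁`) and `pairBil π Δ = (y, z) ↦ ⟨y, Δz⟩_π`
  (`‖·‖ ≤ ‖π‖·#Λ·‖Δ‖` — EXTENSIVE) CONSTRUCTED; **`termsHD_eq`**: with `M := H ∘ D`, `M₃ := H ∘ D₃`, `K := Δ ∘ H ∘ D`,
  f2b's `termsHD π J M M₃ K V₀` = f1's `A ↦ −Jf(H(D₃A)) − P A (H(DA)) + ½P(H(DA))(H(DA)) + V₀(A − H(DA))` pointwise.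
* §3 (J3) BOTH ROUTES FIRED on that `V`.  `norm_le_card_mul_cubic_of_locGrad` (a bond-local `‖locGrad V₀ y‖_∞ ≤ C₀‖y‖²`
  with `V₀ 0 = 0` gives f1's cubic bound with `K₀ = #Λ·C₀`, mean value); **`prop4Hyp_locGrad_termsHD_viaPotential`**
  (f1 ∘ instance ∘ (J1, ⇒)): constant `8·(‖π‖‖J‖₁B₀c₃ + ‖π‖#Λ‖Δ‖B₀c_D + ‖π‖#Λ‖Δ‖B₀²c_D²∕2 + 8#ΛC₀)`, radius `r∕2`;
  **`prop4Hyp_locGrad_termsHD_viaLocal`** (f2b ∘ chain rule): from `‖H‖ ≤ B₀` AND `‖Hw‖₁ ≤ h₁‖w‖₁`, `‖Δ‖ ≤ δ₀` AND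
  `‖Δw‖₁ ≤ δ₁‖w‖₁`, (55)-type `c_D` and COLUMN-SUM derivative bounds `d₁`, `d₃` for `D`, `D₃`: constant
  `‖π‖·(j₀h₁d₃ + δ₀B₀c_D + δ₁h₁d₁ + (h₁d₁·δ₀B₀c_D + B₀c_D·δ₁h₁d₁)∕2) + 4C₀(1 + h₁d₁)`, radius `r` — NO `#Λ`: the volume
  enters f1's route exactly through the dual (ℓ¹) norms that the ℓ¹ → ℓ¹ binders replace.
* §4 (J4) NON-VACUITY of Route 2's binder list by a diagonal toy with a genuine nonlinearity (`D A = (A(b)²)_b`).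
NOT HERE (said): «decay kernel ⇒ row∕column sums» = the discharge of `h₁`, `δ₁`, `d₁`, `d₃` (crew S66 f3); the commutator
terms (91)–(96) and the weighted norms on `Ω_j` (row S65); the [dict] (node O).  No estimate of Bałaban's is discharged.
-/

noncomputable section

open Metric Set Filter
open scoped Topology

namespace Summit.QuantumFields.BalabanUV.T4Continuum.ShellMeasureGradientTailHDJunction

open Literature.MathematicalPhysics.QuantumFieldTheory.Balaban1983to89
open B11Prop6Scheme (Prop4Hyp)
open ShellMeasureLocalGradientTail (sgl norm_sgl_le locGrad locGrad_apply fderiv_apply_eq_sum_locGrad)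
open ShellMeasureGradientTailPairing (norm₁ norm₁_nonneg pair norm_pair_le_sup_one norm_pair_le_one_sup
  norm_fderiv_apply_le_locGrad)
open ShellMeasureGradientTailHDLocal (termsHD prop4Hyp_locGrad_termsHD)
open ShellMeasureGradientTailHD (prop4Hyp_of_HD_binders)

variable {Λ : Type*} [Fintype Λ] [DecidableEq Λ] {𝔄 : Type*} [NormedAddCommGroup 𝔄] [NormedSpace ℂ 𝔄]

/-! ## §1 (J1) Transfer between the two (98) currencies on bond fields: `locGrad` ↔ `fderiv` -/

omit [DecidableEq Λ] [NormedSpace ℂ 𝔄] in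
/-- The ℓ¹ size is at most `#Λ` times the sup norm: `‖h‖₁ ≤ #Λ·‖h‖_∞` — THE place where the volume enters. [folklore] -/
theorem norm₁_le_card_mul_norm (h : Λ → 𝔄) : norm₁ h ≤ Fintype.card Λ * ‖h‖ := by
  unfold norm₁
  calc ∑ b, ‖h b‖ ≤ ∑ _b : Λ, ‖h‖ := Finset.sum_le_sum fun b _ => norm_le_pi_norm h b
    _ = Fintype.card Λ * ‖h‖ := by rw [Finset.sum_const, Finset.card_univ, nsmul_eq_mul]

/-- **POTENTIAL-LEVEL ⟹ BOND-LOCAL, SAME CONSTANT**: `‖locGrad V A‖_∞ ≤ ‖DV(A)‖` (each `DV(A) ∘ ι_b` has norm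
`≤ ‖DV(A)‖·‖ι_b‖ ≤ ‖DV(A)‖`). [folklore] -/
theorem norm_locGrad_le_norm_fderiv (V : (Λ → 𝔄) → ℂ) (A : Λ → 𝔄) : ‖locGrad V A‖ ≤ ‖fderiv ℂ V A‖ := by
  refine (pi_norm_le_iff_of_nonneg (norm_nonneg _)).2 fun b => (ContinuousLinearMap.opNorm_comp_le _ _).trans ?_
  exact mul_le_of_le_one_right (norm_nonneg _) (norm_sgl_le b)

/-- **BOND-LOCAL ⟹ POTENTIAL-LEVEL, WITH THE VOLUME FACTOR**: `‖DV(A)‖ ≤ #Λ·‖locGrad V A‖_∞` (f2a's key device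
`|DV(A)h| ≤ ‖locGrad V A‖_∞·‖h‖₁` and `‖h‖₁ ≤ #Λ·‖h‖_∞`). [folklore] -/
theorem norm_fderiv_le_card_mul_norm_locGrad (V : (Λ → 𝔄) → ℂ) (A : Λ → 𝔄) :
    ‖fderiv ℂ V A‖ ≤ Fintype.card Λ * ‖locGrad V A‖ := by
  refine ContinuousLinearMap.opNorm_le_bound _ (by positivity) fun h => ?_
  calc ‖fderiv ℂ V A h‖ ≤ ‖locGrad V A‖ * norm₁ h := norm_fderiv_apply_le_locGrad V A h
    _ ≤ ‖locGrad V A‖ * (Fintype.card Λ * ‖h‖) := by gcongr; exact norm₁_le_card_mul_norm h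
    _ = Fintype.card Λ * ‖locGrad V A‖ * ‖h‖ := by ring

/-- The full derivative reassembled from the bond-local pieces: `DV(A) = Σ_b (locGrad V A b) ∘ pr_b`. [folklore] -/
theorem fderiv_eq_sum_locGrad_comp_proj (V : (Λ → 𝔄) → ℂ) (A : Λ → 𝔄) :
    fderiv ℂ V A = ∑ b, (locGrad V A b).comp (ContinuousLinearMap.proj b) := by
  ext h
  rw [fderiv_apply_eq_sum_locGrad, FunLike.coe_sum, Finset.sum_apply]
  rfl

/-- `locGrad V` and `fderiv ℂ V` are differentiable on the same sets (finite sums of compositions with fixed CLMs). [folklore] -/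
theorem differentiableOn_locGrad_iff {V : (Λ → 𝔄) → ℂ} {s : Set (Λ → 𝔄)} :
    DifferentiableOn ℂ (locGrad V) s ↔ DifferentiableOn ℂ (fderiv ℂ V) s := by
  constructor
  · intro h
    have hb := differentiableOn_pi.1 h
    have hf : fderiv ℂ V = fun A => ∑ b, (locGrad V A b).comp (ContinuousLinearMap.proj b) :=
      funext (fderiv_eq_sum_locGrad_comp_proj V)
    rw [hf]
    exact DifferentiableOn.fun_sum fun b _ => (hb b).clm_comp (differentiableOn_const _)
  · intro h
    exact differentiableOn_pi.2 fun b => h.clm_comp (differentiableOn_const (sgl b))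

/-- **(J1, ⇒)** `Prop4Hyp (fderiv ℂ V) C r → Prop4Hyp (locGrad V) C r`: a potential-level (98) bound IS a bond-local
one with the same constant. [folklore] -/
theorem prop4Hyp_locGrad_of_fderiv {V : (Λ → 𝔄) → ℂ} {C r : ℝ} (h : Prop4Hyp (fderiv ℂ V) C r) :
    Prop4Hyp (locGrad V) C r where
  quad Y hY := (norm_locGrad_le_norm_fderiv V Y).trans (h.quad Y hY)
  differentiableOn := differentiableOn_locGrad_iff.2 h.differentiableOn

/-- **(J1, ⇐)** `Prop4Hyp (locGrad V) C r → Prop4Hyp (fderiv ℂ V) (#Λ·C) r`: a bond-local (98) bound gives the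
potential-level one at the price of ONE volume factor — displayed here, and only in this direction. [folklore] -/
theorem prop4Hyp_fderiv_of_locGrad {V : (Λ → 𝔄) → ℂ} {C r : ℝ} (h : Prop4Hyp (locGrad V) C r) :
    Prop4Hyp (fderiv ℂ V) (Fintype.card Λ * C) r where
  quad Y hY := by
    calc ‖fderiv ℂ V Y‖ ≤ Fintype.card Λ * ‖locGrad V Y‖ := norm_fderiv_le_card_mul_norm_locGrad V Y
      _ ≤ Fintype.card Λ * (C * ‖Y‖ ^ 2) := by gcongr; exact h.quad Y hY
      _ = Fintype.card Λ * C * ‖Y‖ ^ 2 := by ring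
  differentiableOn := differentiableOn_locGrad_iff.1 h.differentiableOn

/-! ## §2 (J2) The common instance: f1's functionals `Jf`, `P` CONSTRUCTED from the bond pairing, and `termsHD` IS (80) -/

/-- `⟨J, ·⟩_π` as a continuous linear functional on bond fields (f1's source functional `Jf` on the instance).
[folklore] -/
def pairCLM (π : 𝔄 →L[ℂ] 𝔄 →L[ℂ] ℂ) (J : Λ → 𝔄) : (Λ → 𝔄) →L[ℂ] ℂ :=
  ∑ b, (π (J b)).comp (ContinuousLinearMap.proj b)

omit [DecidableEq Λ] in
/-- `pairCLM π J B = ⟨J, B⟩_π`. [folklore] -/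
theorem pairCLM_apply (π : 𝔄 →L[ℂ] 𝔄 →L[ℂ] ℂ) (J B : Λ → 𝔄) : pairCLM π J B = pair π J B := by
  simp [pairCLM, pair]

omit [DecidableEq Λ] in
/-- `‖⟨J, ·⟩_π‖ ≤ ‖π‖·‖J‖₁` — the source functional's norm is paid in the ℓ¹ size of `J`. [folklore] -/
theorem norm_pairCLM_le (π : 𝔄 →L[ℂ] 𝔄 →L[ℂ] ℂ) (J : Λ → 𝔄) : ‖pairCLM π J‖ ≤ ‖π‖ * norm₁ J :=
  ContinuousLinearMap.opNorm_le_bound _ (mul_nonneg (norm_nonneg π) (norm₁_nonneg J)) fun B => by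
    rw [pairCLM_apply]
    exact norm_pair_le_one_sup π J B

/-- `(y, z) ↦ ⟨y, Δ z⟩_π` as a continuous bilinear form on bond fields (f1's pairing `P` on the instance, `Δ` = the
binder behind print's `Δ_π`). [folklore] -/
def pairBil (π : 𝔄 →L[ℂ] 𝔄 →L[ℂ] ℂ) (Δ : (Λ → 𝔄) →L[ℂ] (Λ → 𝔄)) : (Λ → 𝔄) →L[ℂ] (Λ → 𝔄) →L[ℂ] ℂ :=
  ∑ b, π.bilinearComp (ContinuousLinearMap.proj b) ((ContinuousLinearMap.proj b).comp Δ)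

omit [DecidableEq Λ] in
/-- `pairBil π Δ y z = ⟨y, Δ z⟩_π`. [folklore] -/
theorem pairBil_apply (π : 𝔄 →L[ℂ] 𝔄 →L[ℂ] ℂ) (Δ : (Λ → 𝔄) →L[ℂ] (Λ → 𝔄)) (y z : Λ → 𝔄) :
    pairBil π Δ y z = pair π y (Δ z) := by
  simp [pairBil, pair]

omit [DecidableEq Λ] in
/-- `‖(y, z) ↦ ⟨y, Δ z⟩_π‖ ≤ ‖π‖·#Λ·‖Δ‖` — on SUP-normed bond fields the pairing's bilinear norm carries the VOLUME
(`‖Δ z‖₁ ≤ #Λ·‖Δ z‖_∞`): the owner's «f1's binders go EXTENSIVE» made quantitative. [folklore] -/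
theorem norm_pairBil_le (π : 𝔄 →L[ℂ] 𝔄 →L[ℂ] ℂ) (Δ : (Λ → 𝔄) →L[ℂ] (Λ → 𝔄)) :
    ‖pairBil π Δ‖ ≤ ‖π‖ * Fintype.card Λ * ‖Δ‖ := by
  refine ContinuousLinearMap.opNorm_le_bound _ (by positivity) fun y => ?_
  refine ContinuousLinearMap.opNorm_le_bound _ (by positivity) fun z => ?_
  rw [pairBil_apply]
  calc ‖pair π y (Δ z)‖ ≤ ‖π‖ * ‖y‖ * norm₁ (Δ z) := norm_pair_le_sup_one π y (Δ z)
    _ ≤ ‖π‖ * ‖y‖ * (Fintype.card Λ * ‖Δ z‖) := by gcongr; exact norm₁_le_card_mul_norm _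
    _ ≤ ‖π‖ * ‖y‖ * (Fintype.card Λ * (‖Δ‖ * ‖z‖)) := by gcongr; exact Δ.le_opNorm z
    _ = ‖π‖ * Fintype.card Λ * ‖Δ‖ * ‖y‖ * ‖z‖ := by ring

section Instance

variable (π : 𝔄 →L[ℂ] 𝔄 →L[ℂ] ℂ) (J : Λ → 𝔄) (H Δ : (Λ → 𝔄) →L[ℂ] (Λ → 𝔄)) (D D₃ : (Λ → 𝔄) → Λ → 𝔄)
  (V₀ : (Λ → 𝔄) → ℂ)

omit [DecidableEq Λ] in
/-- **THE COMMON INSTANCE** (`𝒳 = 𝒴 =` the sup-normed bond fields `Λ → 𝔄`; `M := H ∘ D`, `M₃ := H ∘ D₃`, `K := Δ ∘ H ∘ D`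
for continuous linear `H`, `Δ` and maps `D`, `D₃`): f2b's functional `termsHD π J M M₃ K V₀` IS f1's (80)-functional
`A ↦ −Jf(H(D₃A)) − P A (H(DA)) + ½ P (H(DA)) (H(DA)) + V₀(A − H(DA))` with `Jf := pairCLM π J`, `P := pairBil π Δ` —
pointwise. [folklore] -/
theorem termsHD_eq (A : Λ → 𝔄) :
    termsHD π J (fun A => H (D A)) (fun A => H (D₃ A)) (fun A => Δ (H (D A))) V₀ A =
      -(pairCLM π J) (H (D₃ A)) - (pairBil π Δ) A (H (D A)) +
        (1 / 2 : ℂ) * (pairBil π Δ) (H (D A)) (H (D A)) + V₀ (A - H (D A)) := by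
  simp only [termsHD, pairCLM_apply, pairBil_apply, one_div]

omit [DecidableEq Λ] in
/-- `termsHD_eq` as an equality of functions. [folklore] -/
theorem termsHD_eq_fun :
    termsHD π J (fun A => H (D A)) (fun A => H (D₃ A)) (fun A => Δ (H (D A))) V₀ =
      fun A => -(pairCLM π J) (H (D₃ A)) - (pairBil π Δ) A (H (D A)) +
        (1 / 2 : ℂ) * (pairBil π Δ) (H (D A)) (H (D A)) + V₀ (A - H (D A)) :=
  funext (termsHD_eq π J H Δ D D₃ V₀)

end Instance

/-! ## §3 (J3) Both routes FIRED on the one functional: where the volume enters -/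

/-- **A BOND-LOCAL GRADIENT BOUND GIVES A POTENTIAL-LEVEL CUBIC BOUND WITH ONE VOLUME FACTOR** (mean value along the
segment `[0, y]`, on which `‖DV₀‖ ≤ #Λ·C₀·‖y‖²` by (J1, ⇐)): `V₀(0) = 0` and `‖locGrad V₀ y‖_∞ ≤ C₀‖y‖²` on `ball 0 R₀`
⟹ `‖V₀ y‖ ≤ #Λ·C₀·‖y‖³` there — f1's `K₀` on the instance. [folklore] -/
theorem norm_le_card_mul_cubic_of_locGrad {V₀ : (Λ → 𝔄) → ℂ} {R₀ C₀ : ℝ} (hC₀ : 0 ≤ C₀)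
    (hV₀a : DifferentiableOn ℂ V₀ (ball 0 R₀)) (h0 : V₀ 0 = 0)
    (hV₀g : ∀ y ∈ ball (0 : Λ → 𝔄) R₀, ‖locGrad V₀ y‖ ≤ C₀ * ‖y‖ ^ 2) :
    ∀ y ∈ ball (0 : Λ → 𝔄) R₀, ‖V₀ y‖ ≤ Fintype.card Λ * C₀ * ‖y‖ ^ 3 := by
  intro y hy
  have hyR : ‖y‖ < R₀ := mem_ball_zero_iff.1 hy
  have hs : closedBall (0 : Λ → 𝔄) ‖y‖ ⊆ ball 0 R₀ := closedBall_subset_ball hyR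
  have hdiff : ∀ x ∈ closedBall (0 : Λ → 𝔄) ‖y‖, DifferentiableAt ℂ V₀ x := fun x hx =>
    (hV₀a x (hs hx)).differentiableAt (isOpen_ball.mem_nhds (hs hx))
  have hbound : ∀ x ∈ closedBall (0 : Λ → 𝔄) ‖y‖, ‖fderiv ℂ V₀ x‖ ≤ Fintype.card Λ * C₀ * ‖y‖ ^ 2 := by
    intro x hx
    have hx' : ‖x‖ ≤ ‖y‖ := mem_closedBall_zero_iff.1 hx
    calc ‖fderiv ℂ V₀ x‖ ≤ Fintype.card Λ * ‖locGrad V₀ x‖ := norm_fderiv_le_card_mul_norm_locGrad V₀ x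
      _ ≤ Fintype.card Λ * (C₀ * ‖x‖ ^ 2) := by gcongr; exact hV₀g x (hs hx)
      _ ≤ Fintype.card Λ * (C₀ * ‖y‖ ^ 2) := by gcongr
      _ = Fintype.card Λ * C₀ * ‖y‖ ^ 2 := by ring
  have h := (convex_closedBall (0 : Λ → 𝔄) ‖y‖).norm_image_sub_le_of_norm_fderiv_le (𝕜 := ℂ) hdiff hbound
    (mem_closedBall_self (norm_nonneg y)) (mem_closedBall_zero_iff.2 le_rfl)
  rw [h0, sub_zero, sub_zero] at h
  calc ‖V₀ y‖ ≤ Fintype.card Λ * C₀ * ‖y‖ ^ 2 * ‖y‖ := h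
    _ = Fintype.card Λ * C₀ * ‖y‖ ^ 3 := by ring

section Routes

variable {π : 𝔄 →L[ℂ] 𝔄 →L[ℂ] ℂ} {J : Λ → 𝔄} {H Δ : (Λ → 𝔄) →L[ℂ] (Λ → 𝔄)} {D D₃ : (Λ → 𝔄) → Λ → 𝔄}
  {V₀ : (Λ → 𝔄) → ℂ}

/-- **ROUTE 1 — f1 (POTENTIAL LEVEL) FIRED ON THE INSTANCE.**  From f1's binders on `H`, `D`, `D₃` (`‖H‖ ≤ B₀`, (55)-
type and order-3 sup bounds, analyticity) and the plaquette part's BOND-LOCAL bound `‖locGrad V₀ y‖_∞ ≤ C₀‖y‖²`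
(`V₀ 0 = 0`), f1's `prop4Hyp_of_HD_binders` applies with `Jf := pairCLM π J`, `P := pairBil π Δ`, `j₀ := ‖π‖·‖J‖₁`,
`p₀ := ‖π‖·#Λ·‖Δ‖`, `K₀ := #Λ·C₀`, and (J1, ⇒) returns its conclusion to the bond-local currency for the SAME `V`
(`termsHD_eq_fun`) — `#Λ` sits in `p₀` (twice) and `K₀`; `‖J‖₁` is itself extensive for an O(1)-per-bond source. [folklore] -/
theorem prop4Hyp_locGrad_termsHD_viaPotential {B₀ R c_D c₃ R₀ C₀ r : ℝ} (hB₀ : 0 ≤ B₀) (hH : ‖H‖ ≤ B₀)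
    (hcD : 0 ≤ c_D) (hc₃ : 0 ≤ c₃) (hDd : AnalyticOnNhd ℂ D (ball 0 R)) (hD₃d : AnalyticOnNhd ℂ D₃ (ball 0 R))
    (hD : ∀ A ∈ ball (0 : Λ → 𝔄) R, ‖D A‖ ≤ c_D * ‖A‖ ^ 2)
    (hD₃ : ∀ A ∈ ball (0 : Λ → 𝔄) R, ‖D₃ A‖ ≤ c₃ * ‖A‖ ^ 3)
    (hC₀ : 0 ≤ C₀) (hV₀d : AnalyticOnNhd ℂ V₀ (ball 0 R₀)) (hV₀0 : V₀ 0 = 0)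
    (hV₀g : ∀ y ∈ ball (0 : Λ → 𝔄) R₀, ‖locGrad V₀ y‖ ≤ C₀ * ‖y‖ ^ 2)
    (hr : 0 < r) (hrR : r ≤ R) (hrR₀ : 2 * r ≤ R₀) (hr1 : r ≤ 1) (hsmall : B₀ * c_D * r ≤ 1) :
    Prop4Hyp (locGrad (termsHD π J (fun A => H (D A)) (fun A => H (D₃ A)) (fun A => Δ (H (D A))) V₀))
      (8 * (‖π‖ * norm₁ J * B₀ * c₃ + ‖π‖ * Fintype.card Λ * ‖Δ‖ * B₀ * c_D +
        ‖π‖ * Fintype.card Λ * ‖Δ‖ * B₀ ^ 2 * c_D ^ 2 / 2 + 8 * (Fintype.card Λ * C₀))) (r / 2) := by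
  have h := prop4Hyp_of_HD_binders H hB₀ hH D D₃ hcD hc₃ hDd hD₃d hD hD₃ (pairCLM π J) (norm_pairCLM_le π J)
    (pairBil π Δ) (norm_pairBil_le π Δ) V₀ (by positivity : (0 : ℝ) ≤ Fintype.card Λ * C₀) hV₀d
    (norm_le_card_mul_cubic_of_locGrad hC₀ hV₀d.differentiableOn hV₀0 hV₀g) hr hrR hrR₀ hr1 hsmall
  rw [termsHD_eq_fun]
  exact prop4Hyp_locGrad_of_fderiv h

/-- **ROUTE 2 — f2b (BOND-LOCAL) FIRED ON THE INSTANCE.**  From VOLUME-FREE binders on the SAME operators — `H` with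
`‖H‖ ≤ B₀` (sup → sup) AND `‖H w‖₁ ≤ h₁‖w‖₁` (ℓ¹ → ℓ¹: column sums), `Δ` likewise (`δ₀`, `δ₁`), `D` with the (55)-type sup
bound `c_D` and the column-sum derivative bound `‖DD(A)(ι_b X)‖₁ ≤ d₁‖A‖‖X‖`, `D₃` with `‖DD₃(A)(ι_b X)‖₁ ≤ d₃‖A‖²‖X‖`,
`‖J‖_∞ ≤ j₀`, `‖locGrad V₀ y‖_∞ ≤ C₀‖y‖²` — f2b's binders follow by the chain rule (`m_∞ = B₀c_D`, `m₁ = h₁d₁`,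
`k_∞ = δ₀B₀c_D`, `k₁ = δ₁h₁d₁`, `c₃ = h₁d₃`) and `prop4Hyp_locGrad_termsHD` fires for the SAME `V` at radius `r` with NO
`#Λ`: the volume enters Route 1 exactly through the dual (ℓ¹) norms that `h₁`, `δ₁`, `d₁`, `d₃` replace. [folklore] -/
theorem prop4Hyp_locGrad_termsHD_viaLocal {B₀ h₁ δ₀ δ₁ c_D d₁ d₃ R₀ C₀ j₀ r : ℝ}
    (hB₀ : 0 ≤ B₀) (hh₁ : 0 ≤ h₁) (hδ₀ : 0 ≤ δ₀) (hδ₁ : 0 ≤ δ₁) (hcD : 0 ≤ c_D) (hd₁ : 0 ≤ d₁) (hd₃ : 0 ≤ d₃)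
    (hC₀ : 0 ≤ C₀) (hH : ‖H‖ ≤ B₀) (hH₁ : ∀ w, norm₁ (H w) ≤ h₁ * norm₁ w) (hΔ : ‖Δ‖ ≤ δ₀)
    (hΔ₁ : ∀ w, norm₁ (Δ w) ≤ δ₁ * norm₁ w) (hJ : ‖J‖ ≤ j₀)
    (hDd : AnalyticOnNhd ℂ D (ball 0 r)) (hD₃d : AnalyticOnNhd ℂ D₃ (ball 0 r))
    (hD : ∀ A ∈ ball (0 : Λ → 𝔄) r, ‖D A‖ ≤ c_D * ‖A‖ ^ 2)
    (hD' : ∀ A ∈ ball (0 : Λ → 𝔄) r, ∀ (b : Λ) (X : 𝔄),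
      norm₁ (fderiv ℂ D A (Pi.single b X)) ≤ d₁ * ‖A‖ * ‖X‖)
    (hD₃' : ∀ A ∈ ball (0 : Λ → 𝔄) r, ∀ (b : Λ) (X : 𝔄),
      norm₁ (fderiv ℂ D₃ A (Pi.single b X)) ≤ d₃ * ‖A‖ ^ 2 * ‖X‖)
    (hV₀d : AnalyticOnNhd ℂ V₀ (ball 0 R₀))
    (hV₀g : ∀ y ∈ ball (0 : Λ → 𝔄) R₀, ‖locGrad V₀ y‖ ≤ C₀ * ‖y‖ ^ 2)
    (hr : 0 < r) (hr1 : r ≤ 1) (hrR₀ : 2 * r ≤ R₀) (hsmall : B₀ * c_D * r ≤ 1) :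
    Prop4Hyp (locGrad (termsHD π J (fun A => H (D A)) (fun A => H (D₃ A)) (fun A => Δ (H (D A))) V₀))
      (‖π‖ * (j₀ * (h₁ * d₃) + δ₀ * (B₀ * c_D) + δ₁ * (h₁ * d₁) +
          (h₁ * d₁ * (δ₀ * (B₀ * c_D)) + B₀ * c_D * (δ₁ * (h₁ * d₁))) / 2) +
        4 * C₀ * (1 + h₁ * d₁)) r := by
  have hMa : AnalyticOnNhd ℂ (fun A => H (D A)) (ball (0 : Λ → 𝔄) r) := fun A hA =>
    (H.analyticAt _).comp (hDd A hA)
  have hM₃a : AnalyticOnNhd ℂ (fun A => H (D₃ A)) (ball (0 : Λ → 𝔄) r) := fun A hA =>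
    (H.analyticAt _).comp (hD₃d A hA)
  have hKa : AnalyticOnNhd ℂ (fun A => Δ (H (D A))) (ball (0 : Λ → 𝔄) r) := fun A hA =>
    (Δ.analyticAt _).comp (hMa A hA)
  have hMb : ∀ A ∈ ball (0 : Λ → 𝔄) r, ‖H (D A)‖ ≤ B₀ * c_D * ‖A‖ ^ 2 := fun A hA =>
    (H.le_opNorm _).trans (by
      calc ‖H‖ * ‖D A‖ ≤ B₀ * (c_D * ‖A‖ ^ 2) := mul_le_mul hH (hD A hA) (norm_nonneg _) hB₀
        _ = B₀ * c_D * ‖A‖ ^ 2 := by ring)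
  have hKb : ∀ A ∈ ball (0 : Λ → 𝔄) r, ‖Δ (H (D A))‖ ≤ δ₀ * (B₀ * c_D) * ‖A‖ ^ 2 := fun A hA =>
    (Δ.le_opNorm _).trans (by
      calc ‖Δ‖ * ‖H (D A)‖ ≤ δ₀ * (B₀ * c_D * ‖A‖ ^ 2) := mul_le_mul hΔ (hMb A hA) (norm_nonneg _) hδ₀
        _ = δ₀ * (B₀ * c_D) * ‖A‖ ^ 2 := by ring)
  have hfM : ∀ A ∈ ball (0 : Λ → 𝔄) r, fderiv ℂ (fun A => H (D A)) A = H.comp (fderiv ℂ D A) := fun A hA =>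
    (H.hasFDerivAt.comp A (hDd A hA).differentiableAt.hasFDerivAt).fderiv
  have hfM₃ : ∀ A ∈ ball (0 : Λ → 𝔄) r, fderiv ℂ (fun A => H (D₃ A)) A = H.comp (fderiv ℂ D₃ A) := fun A hA =>
    (H.hasFDerivAt.comp A (hD₃d A hA).differentiableAt.hasFDerivAt).fderiv
  have hfK : ∀ A ∈ ball (0 : Λ → 𝔄) r, fderiv ℂ (fun A => Δ (H (D A))) A = (Δ.comp H).comp (fderiv ℂ D A) :=
    fun A hA => ((Δ.comp H).hasFDerivAt.comp A (hDd A hA).differentiableAt.hasFDerivAt).fderiv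
  have hM' : ∀ A ∈ ball (0 : Λ → 𝔄) r, ∀ (b : Λ) (X : 𝔄),
      norm₁ (fderiv ℂ (fun A => H (D A)) A (Pi.single b X)) ≤ h₁ * d₁ * ‖A‖ * ‖X‖ := fun A hA b X => by
    rw [hfM A hA, ContinuousLinearMap.comp_apply]
    calc norm₁ (H (fderiv ℂ D A (Pi.single b X))) ≤ h₁ * norm₁ (fderiv ℂ D A (Pi.single b X)) := hH₁ _
      _ ≤ h₁ * (d₁ * ‖A‖ * ‖X‖) := mul_le_mul_of_nonneg_left (hD' A hA b X) hh₁
      _ = h₁ * d₁ * ‖A‖ * ‖X‖ := by ring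
  have hM₃' : ∀ A ∈ ball (0 : Λ → 𝔄) r, ∀ (b : Λ) (X : 𝔄),
      norm₁ (fderiv ℂ (fun A => H (D₃ A)) A (Pi.single b X)) ≤ h₁ * d₃ * ‖A‖ ^ 2 * ‖X‖ := fun A hA b X => by
    rw [hfM₃ A hA, ContinuousLinearMap.comp_apply]
    calc norm₁ (H (fderiv ℂ D₃ A (Pi.single b X))) ≤ h₁ * norm₁ (fderiv ℂ D₃ A (Pi.single b X)) := hH₁ _
      _ ≤ h₁ * (d₃ * ‖A‖ ^ 2 * ‖X‖) := mul_le_mul_of_nonneg_left (hD₃' A hA b X) hh₁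
      _ = h₁ * d₃ * ‖A‖ ^ 2 * ‖X‖ := by ring
  have hK' : ∀ A ∈ ball (0 : Λ → 𝔄) r, ∀ (b : Λ) (X : 𝔄),
      norm₁ (fderiv ℂ (fun A => Δ (H (D A))) A (Pi.single b X)) ≤ δ₁ * (h₁ * d₁) * ‖A‖ * ‖X‖ := by
    intro A hA b X
    rw [hfK A hA, ContinuousLinearMap.comp_apply, ContinuousLinearMap.comp_apply]
    calc norm₁ (Δ (H (fderiv ℂ D A (Pi.single b X)))) ≤ δ₁ * norm₁ (H (fderiv ℂ D A (Pi.single b X))) := hΔ₁ _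
      _ ≤ δ₁ * (h₁ * (d₁ * ‖A‖ * ‖X‖)) :=
        mul_le_mul_of_nonneg_left ((hH₁ _).trans (mul_le_mul_of_nonneg_left (hD' A hA b X) hh₁)) hδ₁
      _ = δ₁ * (h₁ * d₁) * ‖A‖ * ‖X‖ := by ring
  exact prop4Hyp_locGrad_termsHD hr hr1 hrR₀ (by positivity) (by positivity) (by positivity) (by positivity)
    (by positivity) hC₀ hsmall hJ hMa hM₃a hKa hV₀d hMb hKb hM' hK' hM₃' hV₀g

end Routes

/-! ## §4 (J4) NON-VACUITY of Route 2's binder list: a diagonal (zero-range kernel) toy with a genuine nonlinearity -/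

section Toy

omit [DecidableEq Λ] in
/-- The toy correction `D A = (A(b)²)_b` on `Λ → ℂ`: derivative `DD(A) = (2A(b)·pr_b)_b`. [folklore] -/
theorem toy_hasFDerivAt (A : Λ → ℂ) :
    HasFDerivAt (fun A : Λ → ℂ => fun b => A b ^ 2)
      (ContinuousLinearMap.pi fun b => (2 * A b) • ContinuousLinearMap.proj (R := ℂ) (φ := fun _ : Λ => ℂ) b) A := by
  refine hasFDerivAt_pi.2 fun b => ?_
  have h := (hasFDerivAt_apply (𝕜 := ℂ) b A).mul (hasFDerivAt_apply (𝕜 := ℂ) b A)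
  have h2 : HasFDerivAt (fun A : Λ → ℂ => A b ^ 2)
      (A b • ContinuousLinearMap.proj (R := ℂ) (φ := fun _ : Λ => ℂ) b +
        A b • ContinuousLinearMap.proj (R := ℂ) (φ := fun _ : Λ => ℂ) b) A :=
    h.congr_of_eventuallyEq (Filter.Eventually.of_forall fun A' => by simp [pow_two])
  refine h2.congr_fderiv (ContinuousLinearMap.ext fun v => ?_)
  simp only [_root_.add_apply, FunLike.coe_smul, Pi.smul_apply, smul_eq_mul, ContinuousLinearMap.proj_apply]
  ring

/-- The toy's column sum: `‖DD(A)(ι_b X)‖₁ = 2|A(b)||X| ≤ 2‖A‖‖X‖` (a zero-range kernel: one column entry). [folklore] -/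
theorem toy_colSum (A : Λ → ℂ) (b : Λ) (X : ℂ) :
    norm₁ (fderiv ℂ (fun A : Λ → ℂ => fun b => A b ^ 2) A (Pi.single b X)) ≤ 2 * ‖A‖ * ‖X‖ := by
  rw [(toy_hasFDerivAt A).fderiv]
  unfold norm₁
  have hval : ∀ b', ‖(ContinuousLinearMap.pi fun b => (2 * A b) • ContinuousLinearMap.proj (R := ℂ)
      (φ := fun _ : Λ => ℂ) b) (Pi.single b X : Λ → ℂ) b'‖ = if b' = b then 2 * ‖A b'‖ * ‖X‖ else 0 := fun b' => by
    simp only [ContinuousLinearMap.pi_apply, FunLike.coe_smul, Pi.smul_apply,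
      ContinuousLinearMap.proj_apply, Pi.single_apply, smul_eq_mul]
    split_ifs with h
    · rw [norm_mul, norm_mul, Complex.norm_ofNat]
    · rw [mul_zero, norm_zero]
  simp_rw [hval]
  rw [Finset.sum_ite_eq' Finset.univ b, if_pos (Finset.mem_univ b)]
  have hb : ‖A b‖ ≤ ‖A‖ := norm_le_pi_norm A b
  nlinarith [norm_nonneg X]

omit [DecidableEq Λ] in
/-- The toy's sup bound: `‖(A(b)²)_b‖_∞ ≤ ‖A‖²`. [folklore] -/
theorem toy_sq_bound (A : Λ → ℂ) : ‖(fun b => A b ^ 2 : Λ → ℂ)‖ ≤ 1 * ‖A‖ ^ 2 := by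
  rw [one_mul]
  exact (pi_norm_le_iff_of_nonneg (by positivity)).2 fun b =>
    (norm_pow (A b) 2).trans_le (pow_le_pow_left₀ (norm_nonneg _) (norm_le_pi_norm A b) 2)

omit [DecidableEq Λ] in
/-- The toy is entire (coordinatewise a square of a coordinate projection). [folklore] -/
theorem toy_analyticOnNhd (s : Set (Λ → ℂ)) : AnalyticOnNhd ℂ (fun A : Λ → ℂ => fun b => A b ^ 2) s :=
  fun A _ => AnalyticAt.pi fun b => ((ContinuousLinearMap.proj (R := ℂ) (φ := fun _ : Λ => ℂ) b).analyticAt A).pow 2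

/-- `locGrad` of a constant functional vanishes. [folklore] -/
theorem locGrad_const (c : ℂ) (y : Λ → 𝔄) : locGrad (fun _ : Λ → 𝔄 => c) y = 0 := by
  funext b
  rw [locGrad_apply, fderiv_const_apply, ContinuousLinearMap.zero_comp]
  rfl

/-- **NON-VACUITY OF ROUTE 2.**  Its binder list is met, with a GENUINE nonlinearity, by the diagonal toy `H = Δ = id`
(`B₀ = h₁ = δ₀ = δ₁ = 1`), `D A = (A(b)²)_b` (`c_D = 1`, `d₁ = 2`), `D₃ = 0`, `J = 0`, `V₀ = 0`, `r = 1∕2`, `R₀ = 1`: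
`Prop4Hyp (locGrad (termsHD π 0 D 0 D 0)) (5‖π‖) (1∕2)` on `Λ → ℂ` — an instance, not an estimate of anything printed. [folklore] -/
theorem nonvacuity_viaLocal (π : ℂ →L[ℂ] ℂ →L[ℂ] ℂ) :
    Prop4Hyp (locGrad (termsHD π (0 : Λ → ℂ) (fun A b => A b ^ 2) (fun _ => 0) (fun A b => A b ^ 2) (fun _ => 0)))
      (‖π‖ * 5) (1 / 2) := by
  have h := prop4Hyp_locGrad_termsHD_viaLocal (Λ := Λ) (𝔄 := ℂ) (π := π) (J := 0)
    (H := ContinuousLinearMap.id ℂ (Λ → ℂ)) (Δ := ContinuousLinearMap.id ℂ (Λ → ℂ))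
    (D := fun A b => A b ^ 2) (D₃ := fun _ => 0) (V₀ := fun _ => 0)
    (B₀ := 1) (h₁ := 1) (δ₀ := 1) (δ₁ := 1) (c_D := 1) (d₁ := 2) (d₃ := 0) (R₀ := 1) (C₀ := 0) (j₀ := 0) (r := 1 / 2)
    zero_le_one zero_le_one zero_le_one zero_le_one zero_le_one zero_le_two le_rfl le_rfl
    ContinuousLinearMap.norm_id_le (fun w => by rw [one_mul]; rfl) ContinuousLinearMap.norm_id_le
    (fun w => by rw [one_mul]; rfl) (by rw [norm_zero])
    (toy_analyticOnNhd _) (fun A _ => analyticAt_const) (fun A _ => toy_sq_bound A) (fun A _ b X => toy_colSum A b X)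
    (fun A _ b X => by rw [fderiv_const_apply]; simp [norm₁]) (fun A _ => analyticAt_const)
    (fun y _ => by rw [locGrad_const, norm_zero, zero_mul]) (by norm_num) (by norm_num) (by norm_num) (by norm_num)
  have hc : ‖π‖ * (0 * (1 * 0) + 1 * (1 * 1) + 1 * (1 * 2) + (1 * 2 * (1 * (1 * 1)) + 1 * 1 * (1 * (1 * 2))) / 2) +
      4 * 0 * (1 + 1 * 2) = ‖π‖ * 5 := by ring
  exact hc ▸ h

end Toy

end Summit.QuantumFields.BalabanUV.T4Continuum.ShellMeasureGradientTailHDJunction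

end
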